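import Summits.RiemannHypothesis.RiemannHypothesis.Theorems.LiTailLaguerreNonreleased
import Summits.RiemannHypothesis.RiemannHypothesis.Theorems.LiTailLaguerreGammaTailWeights
import Summits.RiemannHypothesis.RiemannHypothesis.Theorems.LiPrimeEchoGammaShift
import Mathlib.Analysis.Complex.CauchyIntegral
import HarnessLib

/-!
# RiemannHypothesis / LiTailLaguerre — crux K2′ `LiPrimeTailLaguerre`, part 2: weights on the strip and the Cauchy
# shift of one prime-power term to the critical line (RH-FREE)

RH-FREE [rh-li-prover g5].  Route `Theses/LiTailLaguerre.lean` (round 7, leaf `LiTheory.LiZeroTailLaguerre`), item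
`LiPrimeTailLaguerre` (stmt-RiemannHypothesis-19702, DECIDING).  Weights at `w = x + iY`, `1/2 ≤ x ≤ 3/2`:
`F_n(w)F_n(1 − w) = 1`, `2 − k_n(w) = (1 − F_n(w))(1 − F_n(1 − w))`, `‖F_n(w)‖ ≤ 1`, `‖F_n(1 − w)‖ ≤ e^{n/Y²}`,
`‖1 − F_n(w)‖ ≤ n/‖w‖`, `‖1 − F_n(1 − w)‖ ≤ n e^{n/Y²}/‖w − 1‖`, hence `‖2 − k_n‖ ≤ 3 + e^{n/Y²}`, `≤ n² e^{n/Y²}/Y²`, and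
`≤ n²/(¼ + t²)` on the critical line.  Then for `G(w) = m^{−w}(2 − k_n(w))` (analytic off `{0, 1}`), Cauchy on
`[1/2, 3/2] × [T, Y]` and `Y → ∞`: `∫_{Ioi T} m^{−(3/2+iy)}(2 − k_n) dy = ∫_{Ioi T} G(½ + it) dt + i ∫_{1/2}^{3/2} G(x + iT) dx`,
the connector being `≤ m^{−1/2}(3 + e^{n/T²})`.  Nothing here bears on the truth of RH.
-/

noncomputable section

-- D-0017: `Summit.<S>.<S>.…` is the designed namespace of a single-problem summit.
set_option linter.dupNamespace false

open Complex MeasureTheory intervalIntegral Set Filter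
open scoped Real Interval Topology ArithmeticFunction.vonMangoldt

namespace Summit.RiemannHypothesis.RiemannHypothesis.Theorems.LiTheory

open Literature.NumberTheory.LFunctions

namespace PrimeTail

open PrimeEdge TailContour GammaShift
/-! ### Geometric-sum bounds for `1 − zⁿ` -/
/-- `‖1 − zⁿ‖ ≤ n ‖1 − z‖ B` when every power `‖z^i‖ ≤ B` (`i ≤ n`). -/
theorem norm_one_sub_pow_le_of_pow_le {z : ℂ} {B : ℝ} (n : ℕ) (hB : ∀ i ≤ n, ‖z ^ i‖ ≤ B) :
    ‖1 - z ^ n‖ ≤ n * ‖1 - z‖ * B := by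
  rw [← mul_neg_geom_sum z n, norm_mul]
  have hB0 : 0 ≤ B := (norm_nonneg _).trans (hB 0 (Nat.zero_le _))
  have hsum : ‖∑ i ∈ Finset.range n, z ^ i‖ ≤ n * B := by
    calc ‖∑ i ∈ Finset.range n, z ^ i‖ ≤ ∑ i ∈ Finset.range n, ‖z ^ i‖ := norm_sum_le _ _
      _ ≤ ∑ _i ∈ Finset.range n, B := Finset.sum_le_sum fun i hi ↦ hB i (Finset.mem_range.1 hi).le
      _ = n * B := by simp
  calc ‖1 - z‖ * ‖∑ i ∈ Finset.range n, z ^ i‖ ≤ ‖1 - z‖ * (n * B) := by gcongr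
    _ = n * ‖1 - z‖ * B := by ring

/-- `‖1 − zⁿ‖ ≤ n ‖1 − z‖` when `‖z‖ ≤ 1`. -/
theorem norm_one_sub_pow_le {z : ℂ} (hz : ‖z‖ ≤ 1) (n : ℕ) : ‖1 - z ^ n‖ ≤ n * ‖1 - z‖ := by
  simpa using norm_one_sub_pow_le_of_pow_le n (B := 1) fun i _ ↦ by
    rw [norm_pow]; exact pow_le_one₀ (norm_nonneg _) hz

/-! ### The weights at a point `w = x + iY` of the strip -/
/-- `F_n(w) F_n(1 − w) = 1` (`w ≠ 0, 1`). -/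
theorem liWeight_mul_liWeight_one_sub (n : ℕ) {w : ℂ} (h0 : w ≠ 0) (h1 : w ≠ 1) :
    liWeight n w * liWeight n (1 - w) = 1 := by
  unfold liWeight
  have h1' : (1 : ℂ) - w ≠ 0 := sub_ne_zero.2 (Ne.symm h1)
  have hw1 : w - 1 ≠ 0 := sub_ne_zero.2 h1
  rw [← mul_pow]
  have : (1 - 1 / w) * (1 - 1 / (1 - w)) = 1 := by
    field_simp
    ring
  rw [this, one_pow]

/-- The product formula `2 − k_n(w) = (1 − F_n(w))(1 − F_n(1 − w))` (`w ≠ 0, 1`). -/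
theorem liCoSymWeight_eq_mul (n : ℕ) {w : ℂ} (h0 : w ≠ 0) (h1 : w ≠ 1) :
    liCoSymWeight n w = (1 - liWeight n w) * (1 - liWeight n (1 - w)) := by
  have h := liWeight_mul_liWeight_one_sub n h0 h1
  unfold liCoSymWeight liSymWeight
  linear_combination -h

/-- `‖1 − 1/w‖ ≤ 1` for `Re w ≥ 1/2` (`w ≠ 0`). -/
theorem norm_one_sub_inv_le_one {w : ℂ} (hw : 1 / 2 ≤ w.re) (h0 : w ≠ 0) : ‖1 - 1 / w‖ ≤ 1 := by
  rw [show (1 : ℂ) - 1 / w = (w - 1) / w by field_simp, norm_div, div_le_one (norm_pos_iff.2 h0)]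
  have h1 : ‖w - 1‖ ^ 2 ≤ ‖w‖ ^ 2 := by
    rw [Complex.sq_norm, Complex.sq_norm, Complex.normSq_apply, Complex.normSq_apply]
    simp
    nlinarith
  exact (pow_le_pow_iff_left₀ (norm_nonneg _) (norm_nonneg _) two_ne_zero).1 h1

/-- `‖1 − 1/(1 − w)‖² ≤ 1 + 2/Y²` for `w = x + iY`, `x ≤ 3/2`, `Y ≠ 0`. -/
theorem norm_sq_one_sub_inv_one_sub_le {x Y : ℝ} (hx : x ≤ 3 / 2) (hY : Y ≠ 0) :
    ‖1 - 1 / (1 - ((x : ℂ) + Y * I))‖ ^ 2 ≤ 1 + 2 / Y ^ 2 := by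
  set w : ℂ := x + Y * I with hw
  have hY2 : 0 < Y ^ 2 := by positivity
  have h1 : (1 : ℂ) - w ≠ 0 := by
    intro h; have := congrArg Complex.im h; simp [hw] at this; exact hY this
  have hw1 : w - 1 ≠ 0 := by
    intro h; have := congrArg Complex.im h; simp [hw] at this; exact hY this
  have heq : (1 : ℂ) - 1 / (1 - w) = w / (w - 1) := by field_simp; ring
  rw [heq, norm_div, div_pow]
  have hd : ‖w - 1‖ ^ 2 = (x - 1) ^ 2 + Y ^ 2 := by
    rw [Complex.sq_norm, Complex.normSq_apply]; simp [hw]; ring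
  have hn : ‖w‖ ^ 2 = x ^ 2 + Y ^ 2 := by
    rw [Complex.sq_norm, Complex.normSq_apply]; simp [hw]; ring
  rw [hd, hn, div_le_iff₀ (by positivity)]
  have : (1 + 2 / Y ^ 2) * ((x - 1) ^ 2 + Y ^ 2) = (x - 1) ^ 2 + Y ^ 2 + 2 * (x - 1) ^ 2 / Y ^ 2 + 2 := by
    field_simp
    ring
  rw [this]
  have h2 : 0 ≤ 2 * (x - 1) ^ 2 / Y ^ 2 := by positivity
  nlinarith

/-- `‖F_n(1 − w)‖ ≤ e^{n/Y²}` for `w = x + iY`, `x ≤ 3/2`, `Y ≠ 0`; more generally every power `i ≤ n` of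
`1 − 1/(1 − w)` has norm `≤ e^{n/Y²}`. -/
theorem norm_pow_one_sub_inv_one_sub_le (n : ℕ) {x Y : ℝ} (hx : x ≤ 3 / 2) (hY : Y ≠ 0) {i : ℕ} (hi : i ≤ n) :
    ‖(1 - 1 / (1 - ((x : ℂ) + Y * I))) ^ i‖ ≤ Real.exp (n / Y ^ 2) := by
  set q : ℝ := ‖1 - 1 / (1 - ((x : ℂ) + Y * I))‖ with hq
  have hq0 : 0 ≤ q := norm_nonneg _
  have hsq := norm_sq_one_sub_inv_one_sub_le hx hY
  rw [norm_pow]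
  have hY2 : 0 < Y ^ 2 := by positivity
  have h2 : (q ^ i) ^ 2 ≤ Real.exp (n / Y ^ 2) ^ 2 := by
    rw [← pow_mul, mul_comm, pow_mul]
    calc (q ^ 2) ^ i ≤ (1 + 2 / Y ^ 2) ^ i := pow_le_pow_left₀ (sq_nonneg _) hsq i
      _ ≤ Real.exp (2 / Y ^ 2) ^ i := by
          refine pow_le_pow_left₀ (by positivity) ?_ i
          have := Real.add_one_le_exp (2 / Y ^ 2); linarith
      _ = Real.exp (2 * i / Y ^ 2) := by rw [← Real.exp_nat_mul]; congr 1; ring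
      _ ≤ Real.exp (2 * n / Y ^ 2) := by
          refine Real.exp_le_exp.2 (div_le_div_of_nonneg_right ?_ hY2.le)
          have : (i : ℝ) ≤ n := by exact_mod_cast hi
          linarith
      _ = Real.exp (n / Y ^ 2) ^ 2 := by rw [← Real.exp_nat_mul]; congr 1; push_cast; ring
  exact (pow_le_pow_iff_left₀ (pow_nonneg hq0 _) (Real.exp_pos _).le two_ne_zero).1 h2

/-- `‖F_n(1 − w)‖ ≤ e^{n/Y²}` for `w = x + iY`, `x ≤ 3/2`, `Y ≠ 0`. -/
theorem norm_liWeight_one_sub_le_exp (n : ℕ) {x Y : ℝ} (hx : x ≤ 3 / 2) (hY : Y ≠ 0) :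
    ‖liWeight n (1 - ((x : ℂ) + Y * I))‖ ≤ Real.exp (n / Y ^ 2) :=
  norm_pow_one_sub_inv_one_sub_le n hx hY le_rfl

/-- `‖1 − F_n(w)‖ ≤ n/‖w‖` for `Re w ≥ 1/2` (`w ≠ 0`). -/
theorem norm_one_sub_liWeight_le (n : ℕ) {w : ℂ} (hw : 1 / 2 ≤ w.re) (h0 : w ≠ 0) :
    ‖1 - liWeight n w‖ ≤ n / ‖w‖ := by
  unfold liWeight
  refine (norm_one_sub_pow_le (norm_one_sub_inv_le_one hw h0) n).trans (le_of_eq ?_)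
  rw [show (1 : ℂ) - (1 - 1 / w) = 1 / w by ring, norm_div, norm_one]
  ring

/-- `‖1 − F_n(1 − w)‖ ≤ n e^{n/Y²}/‖w − 1‖` for `w = x + iY`, `x ≤ 3/2`, `Y ≠ 0`. -/
theorem norm_one_sub_liWeight_one_sub_le (n : ℕ) {x Y : ℝ} (hx : x ≤ 3 / 2) (hY : Y ≠ 0) :
    ‖1 - liWeight n (1 - ((x : ℂ) + Y * I))‖ ≤ n * Real.exp (n / Y ^ 2) / ‖((x : ℂ) + Y * I) - 1‖ := by
  set w : ℂ := x + Y * I with hw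
  have h1 : (1 : ℂ) - w ≠ 0 := by
    intro h; have := congrArg Complex.im h; simp [hw] at this; exact hY this
  unfold liWeight
  refine (norm_one_sub_pow_le_of_pow_le n fun i hi ↦ norm_pow_one_sub_inv_one_sub_le n hx hY hi).trans
    (le_of_eq ?_)
  rw [show (1 : ℂ) - (1 - 1 / (1 - w)) = 1 / (1 - w) by ring, norm_div, norm_one,
    show (1 : ℂ) - w = -(w - 1) by ring, norm_neg]
  ring

/-- **Trivial bound** `‖2 − k_n(x + iY)‖ ≤ 3 + e^{n/Y²}` (`1/2 ≤ x ≤ 3/2`, `Y ≠ 0`). -/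
theorem norm_liCoSymWeight_le_three_add (n : ℕ) {x Y : ℝ} (hx : x ∈ Icc (1 / 2 : ℝ) (3 / 2)) (hY : Y ≠ 0) :
    ‖liCoSymWeight n ((x : ℂ) + Y * I)‖ ≤ 3 + Real.exp (n / Y ^ 2) := by
  set w : ℂ := x + Y * I with hw
  have h0 : w ≠ 0 := by
    intro h; have := congrArg Complex.im h; simp [hw] at this; exact hY this
  have hre : 1 / 2 ≤ w.re := by simpa [hw] using hx.1
  unfold liCoSymWeight liSymWeight
  calc ‖2 - (liWeight n w + liWeight n (1 - w))‖ ≤ ‖(2 : ℂ)‖ + ‖liWeight n w + liWeight n (1 - w)‖ := norm_sub_le _ _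
    _ ≤ 2 + (‖liWeight n w‖ + ‖liWeight n (1 - w)‖) := by
        gcongr
        · simp
        · exact norm_add_le _ _
    _ ≤ 2 + (1 + Real.exp (n / Y ^ 2)) := by
        gcongr
        · exact GammaTail.norm_liWeight_le_one n hre h0
        · exact norm_liWeight_one_sub_le_exp n hx.2 hY
    _ = 3 + Real.exp (n / Y ^ 2) := by ring

/-- **Decay bound** `‖2 − k_n(x + iY)‖ ≤ n² e^{n/Y²}/Y²` (`1/2 ≤ x ≤ 3/2`, `Y > 0`). -/
theorem norm_liCoSymWeight_le_decay (n : ℕ) {x Y : ℝ} (hx : x ∈ Icc (1 / 2 : ℝ) (3 / 2)) (hY : 0 < Y) :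
    ‖liCoSymWeight n ((x : ℂ) + Y * I)‖ ≤ (n : ℝ) ^ 2 * Real.exp (n / Y ^ 2) / Y ^ 2 := by
  set w : ℂ := x + Y * I with hw
  have hY0 : Y ≠ 0 := hY.ne'
  have h0 : w ≠ 0 := by
    intro h; have := congrArg Complex.im h; simp [hw] at this; exact hY0 this
  have h1 : w ≠ 1 := by
    intro h; have := congrArg Complex.im h; simp [hw] at this; exact hY0 this
  have hre : 1 / 2 ≤ w.re := by simpa [hw] using hx.1
  have hYw : Y ≤ ‖w‖ := by
    have : |w.im| ≤ ‖w‖ := Complex.abs_im_le_norm w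
    simpa [hw, abs_of_pos hY] using this
  have hYw1 : Y ≤ ‖w - 1‖ := by
    have : |(w - 1).im| ≤ ‖w - 1‖ := Complex.abs_im_le_norm (w - 1)
    simpa [hw, abs_of_pos hY] using this
  rw [liCoSymWeight_eq_mul n h0 h1, norm_mul]
  have hA := norm_one_sub_liWeight_le n hre h0
  have hB := norm_one_sub_liWeight_one_sub_le n hx.2 hY0
  calc ‖1 - liWeight n w‖ * ‖1 - liWeight n (1 - w)‖
      ≤ (n / ‖w‖) * (n * Real.exp (n / Y ^ 2) / ‖w - 1‖) :=
        mul_le_mul hA hB (norm_nonneg _) (by positivity)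
    _ ≤ (n / Y) * (n * Real.exp (n / Y ^ 2) / Y) := by gcongr
    _ = (n : ℝ) ^ 2 * Real.exp (n / Y ^ 2) / Y ^ 2 := by ring

/-- **Critical line**: `‖2 − k_n(½ + it)‖ ≤ n²/(¼ + t²)` (all real `t`). -/
theorem norm_liCoSymWeight_half_le (n : ℕ) (t : ℝ) :
    ‖liCoSymWeight n (1 / 2 + t * I)‖ ≤ (n : ℝ) ^ 2 / (1 / 4 + t ^ 2) := by
  set w : ℂ := 1 / 2 + t * I with hw
  have hnsq : ‖w‖ ^ 2 = 1 / 4 + t ^ 2 := by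
    rw [Complex.sq_norm, Complex.normSq_apply]; simp [hw]; ring
  have hnsq1 : ‖w - 1‖ ^ 2 = 1 / 4 + t ^ 2 := by
    rw [Complex.sq_norm, Complex.normSq_apply]; simp [hw]; ring
  have hpos : 0 < 1 / 4 + t ^ 2 := by positivity
  have hw0 : w ≠ 0 := by
    intro h; rw [h, norm_zero] at hnsq; linarith
  have hw1 : w ≠ 1 := by
    intro h; rw [h, sub_self, norm_zero] at hnsq1; linarith
  have h1w : (1 : ℂ) - w ≠ 0 := sub_ne_zero.2 (Ne.symm hw1)
  have hnorm_eq : ‖w - 1‖ = ‖w‖ := by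
    have := hnsq.trans hnsq1.symm
    exact ((pow_le_pow_iff_left₀ (norm_nonneg _) (norm_nonneg _) two_ne_zero).1 this.ge).antisymm
      ((pow_le_pow_iff_left₀ (norm_nonneg _) (norm_nonneg _) two_ne_zero).1 this.le)
  -- both `1 − 1/w` and `1 − 1/(1 − w)` have norm `1`
  have hz : ‖1 - 1 / w‖ ≤ 1 := by
    rw [show (1 : ℂ) - 1 / w = (w - 1) / w by field_simp, norm_div, hnorm_eq, div_self (norm_ne_zero_iff.2 hw0)]
  have hz' : ‖1 - 1 / (1 - w)‖ ≤ 1 := by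
    rw [show (1 : ℂ) - 1 / (1 - w) = w / (w - 1) by field_simp; ring, norm_div, hnorm_eq,
      div_self (norm_ne_zero_iff.2 hw0)]
  rw [liCoSymWeight_eq_mul n hw0 hw1, norm_mul]
  unfold liWeight
  have hA := norm_one_sub_pow_le hz n
  have hB := norm_one_sub_pow_le hz' n
  rw [show (1 : ℂ) - (1 - 1 / w) = 1 / w by ring, norm_div, norm_one] at hA
  have hB' : ‖(1 : ℂ) / (1 - w)‖ = 1 / ‖w‖ := by
    rw [norm_div, norm_one, show (1 : ℂ) - w = -(w - 1) by ring, norm_neg, hnorm_eq]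
  rw [show (1 : ℂ) - (1 - 1 / (1 - w)) = 1 / (1 - w) by ring, hB'] at hB
  have hwpos : 0 < ‖w‖ := norm_pos_iff.2 hw0
  calc ‖1 - (1 - 1 / w) ^ n‖ * ‖1 - (1 - 1 / (1 - w)) ^ n‖ ≤ (n * (1 / ‖w‖)) * (n * (1 / ‖w‖)) :=
        mul_le_mul hA hB (norm_nonneg _) (by positivity)
    _ = (n : ℝ) ^ 2 / ‖w‖ ^ 2 := by field_simp
    _ = (n : ℝ) ^ 2 / (1 / 4 + t ^ 2) := by rw [hnsq]

/-! ### The continuation `G(w) = m^{−w}(2 − k_n(w))` and the Cauchy shift -/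
/-- `G_{n,m}(w) = m^{−w}(2 − k_n(w))`. -/
def G (n m : ℕ) (w : ℂ) : ℂ := (m : ℂ) ^ (-w) * liCoSymWeight n w

/-- `‖m^{−w}‖ = m^{−Re w}` and hence `≤ m^{−1/2}` for `Re w ≥ 1/2` (`m ≥ 1`). -/
theorem norm_cpow_neg_le {m : ℕ} (hm : 0 < m) {w : ℂ} (hw : 1 / 2 ≤ w.re) :
    ‖(m : ℂ) ^ (-w)‖ ≤ (m : ℝ) ^ (-(1 / 2 : ℝ)) := by
  rw [Complex.norm_natCast_cpow_of_pos hm, Complex.neg_re]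
  exact Real.rpow_le_rpow_of_exponent_le (by exact_mod_cast hm) (by linarith)

/-- `G` is differentiable at every `w ≠ 0, 1` (`m ≥ 1`). -/
theorem differentiableAt_G (n : ℕ) {m : ℕ} (hm : 0 < m) {w : ℂ} (h0 : w ≠ 0) (h1 : w ≠ 1) :
    DifferentiableAt ℂ (G n m) w := by
  have hm' : (m : ℂ) ≠ 0 := by exact_mod_cast hm.ne'
  have h1' : (1 : ℂ) - w ≠ 0 := sub_ne_zero.2 (Ne.symm h1)
  have hk : DifferentiableAt ℂ (liCoSymWeight n) w := by
    unfold liCoSymWeight liSymWeight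
    refine (differentiableAt_const _).sub ((differentiableAt_liWeight n h0).add ?_)
    exact (differentiableAt_liWeight n h1').comp w ((differentiableAt_const _).sub differentiableAt_id)
  have hp : DifferentiableAt ℂ (fun w : ℂ ↦ (m : ℂ) ^ (-w)) w :=
    differentiableAt_id.neg.const_cpow (Or.inl hm')
  unfold G
  exact hp.mul hk

/-- `G` is differentiable on the closed rectangle `[1/2, 3/2] × [T, Y]` (`T > 0`). -/
theorem differentiableOn_G (n : ℕ) {m : ℕ} (hm : 0 < m) {T Y : ℝ} (hT : 0 < T) (hTY : T ≤ Y) :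
    DifferentiableOn ℂ (G n m) ([[(1 / 2 : ℝ), 3 / 2]] ×ℂ [[T, Y]]) := by
  intro w hw
  rw [uIcc_of_le (by norm_num : (1 / 2 : ℝ) ≤ 3 / 2), uIcc_of_le hTY, Complex.mem_reProdIm] at hw
  have him : 0 < w.im := hT.trans_le hw.2.1
  have h0 : w ≠ 0 := fun h ↦ by rw [h] at him; simp at him
  have h1 : w ≠ 1 := fun h ↦ by rw [h] at him; simp at him
  exact (differentiableAt_G n hm h0 h1).differentiableWithinAt

/-- `G` is continuous along every line `s ↦ a + s b` avoiding `0` and `1`. -/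
theorem continuous_G_line (n : ℕ) {m : ℕ} (hm : 0 < m) {a b : ℂ} (h : ∀ s : ℝ, a + s * b ≠ 0 ∧ a + s * b ≠ 1) :
    Continuous fun s : ℝ ↦ G n m (a + s * b) := by
  refine continuous_iff_continuousAt.2 fun s ↦ ?_
  have hc : Continuous fun s : ℝ ↦ a + s * b := by fun_prop
  show ContinuousAt ((G n m) ∘ fun s : ℝ ↦ a + s * b) s
  exact ContinuousAt.comp (differentiableAt_G n hm (h s).1 (h s).2).continuousAt hc.continuousAt

/-- Bound on a horizontal segment: `‖G(x + iY)‖ ≤ m^{−1/2}(3 + e^{n/Y²})` (`x ∈ [1/2, 3/2]`, `Y ≠ 0`). -/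
theorem norm_G_le_trivial (n : ℕ) {m : ℕ} (hm : 0 < m) {x Y : ℝ} (hx : x ∈ Icc (1 / 2 : ℝ) (3 / 2)) (hY : Y ≠ 0) :
    ‖G n m ((x : ℂ) + Y * I)‖ ≤ (m : ℝ) ^ (-(1 / 2 : ℝ)) * (3 + Real.exp (n / Y ^ 2)) := by
  unfold G
  rw [norm_mul]
  exact mul_le_mul (norm_cpow_neg_le hm (by simpa using hx.1)) (norm_liCoSymWeight_le_three_add n hx hY)
    (norm_nonneg _) (by positivity)

/-- Bound on a horizontal segment: `‖G(x + iY)‖ ≤ m^{−1/2} n² e^{n/Y²}/Y²` (`x ∈ [1/2, 3/2]`, `Y > 0`). -/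
theorem norm_G_le_decay (n : ℕ) {m : ℕ} (hm : 0 < m) {x Y : ℝ} (hx : x ∈ Icc (1 / 2 : ℝ) (3 / 2)) (hY : 0 < Y) :
    ‖G n m ((x : ℂ) + Y * I)‖ ≤ (m : ℝ) ^ (-(1 / 2 : ℝ)) * ((n : ℝ) ^ 2 * Real.exp (n / Y ^ 2) / Y ^ 2) := by
  unfold G
  rw [norm_mul]
  exact mul_le_mul (norm_cpow_neg_le hm (by simpa using hx.1)) (norm_liCoSymWeight_le_decay n hx hY)
    (norm_nonneg _) (by positivity)

/-- Bound on the critical line: `‖G(½ + it)‖ ≤ m^{−1/2} · 4n²/(1 + t²)`. -/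
theorem norm_G_half_le (n : ℕ) {m : ℕ} (hm : 0 < m) (t : ℝ) :
    ‖G n m (1 / 2 + t * I)‖ ≤ (m : ℝ) ^ (-(1 / 2 : ℝ)) * (4 * (n : ℝ) ^ 2) * (1 + t ^ 2)⁻¹ := by
  unfold G
  rw [norm_mul, mul_assoc]
  refine mul_le_mul (norm_cpow_neg_le hm (by simp)) ((norm_liCoSymWeight_half_le n t).trans ?_) (norm_nonneg _)
    (by positivity)
  rw [div_le_iff₀ (by positivity)]
  have : (1 + t ^ 2)⁻¹ * (1 / 4 + t ^ 2) ≥ 1 / 4 := by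
    rw [ge_iff_le, le_inv_mul_iff₀ (by positivity)]
    nlinarith [sq_nonneg t]
  nlinarith [sq_nonneg (n : ℝ)]

/-- `G(½ + it)` is integrable on `ℝ`. -/
theorem integrable_G_half (n : ℕ) {m : ℕ} (hm : 0 < m) : Integrable fun t : ℝ ↦ G n m (1 / 2 + t * I) := by
  have hc : Continuous fun t : ℝ ↦ G n m (1 / 2 + t * I) :=
    continuous_G_line n hm (a := 1 / 2) (b := I) fun s ↦
      ⟨fun e ↦ by have := congrArg Complex.re e; norm_num at this,
       fun e ↦ by have := congrArg Complex.re e; norm_num at this⟩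
  refine Integrable.mono' ((integrable_inv_one_add_sq).const_mul ((m : ℝ) ^ (-(1 / 2 : ℝ)) * (4 * (n : ℝ) ^ 2)))
    hc.aestronglyMeasurable (Filter.Eventually.of_forall fun t ↦ ?_)
  exact norm_G_half_le n hm t

/-- The connector `∫_{1/2}^{3/2} G(x + iT) dx` is bounded by `m^{−1/2}(3 + e^{n/T²})` (`T ≠ 0`). -/
theorem norm_connector_le (n : ℕ) {m : ℕ} (hm : 0 < m) {T : ℝ} (hT : T ≠ 0) :
    ‖∫ x in (1 / 2 : ℝ)..(3 / 2 : ℝ), G n m (x + T * I)‖ ≤ (m : ℝ) ^ (-(1 / 2 : ℝ)) * (3 + Real.exp (n / T ^ 2)) := by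
  have hpt : ∀ x ∈ Ι (1 / 2 : ℝ) (3 / 2), ‖G n m (x + T * I)‖ ≤ (m : ℝ) ^ (-(1 / 2 : ℝ)) * (3 + Real.exp (n / T ^ 2)) := by
    intro x hx
    rw [uIoc_of_le (by norm_num)] at hx
    exact norm_G_le_trivial n hm ⟨hx.1.le, hx.2⟩ hT
  have h := intervalIntegral.norm_integral_le_of_norm_le_const hpt
  rwa [show |(3 / 2 : ℝ) - 1 / 2| = 1 by norm_num, mul_one] at h

/-- Cauchy on `[1/2, 3/2] × [T, Y]`: right edge = critical line + `i`(bottom connector) − `i`(top connector). -/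
theorem integral_right_eq (n : ℕ) {m : ℕ} (hm : 0 < m) {T Y : ℝ} (hT : 0 < T) (hTY : T ≤ Y) :
    ∫ y in T..Y, G n m (3 / 2 + y * I) = (∫ t in T..Y, G n m (1 / 2 + t * I)) +
      I * (∫ x in (1 / 2 : ℝ)..(3 / 2 : ℝ), G n m (x + T * I)) - I * ∫ x in (1 / 2 : ℝ)..(3 / 2 : ℝ), G n m (x + Y * I) := by
  have hC := Complex.integral_boundary_rect_eq_zero_of_differentiableOn (G n m) (1 / 2 + T * I) (3 / 2 + Y * I) (by
      have h1 : ((1 : ℂ) / 2 + T * I).re = 1 / 2 := by simp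
      have h2 : ((3 : ℂ) / 2 + Y * I).re = 3 / 2 := by simp
      have h3 : ((1 : ℂ) / 2 + T * I).im = T := by simp
      have h4 : ((3 : ℂ) / 2 + Y * I).im = Y := by simp
      rw [h1, h2, h3, h4]
      exact differentiableOn_G n hm hT hTY)
  simp only [Complex.add_re, Complex.add_im, Complex.div_ofNat_re, Complex.one_re, Complex.mul_re, Complex.ofReal_re,
    Complex.I_re, Complex.ofReal_im, Complex.I_im, Complex.div_ofNat_im, Complex.one_im, Complex.mul_im,
    Complex.re_ofNat, Complex.im_ofNat] at hC
  norm_num at hC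
  have hI : I * I = -1 := Complex.I_mul_I
  linear_combination (-I) * hC + ((∫ y in T..Y, G n m (3 / 2 + y * I)) - ∫ t in T..Y, G n m (1 / 2 + t * I)) * hI

/-- **The shift to the critical line** (`m ≥ 1`, `T ≥ 1`):
`∫_{Ioi T} m^{−(3/2+iy)}(2 − k_n) dy = ∫_{Ioi T} G(½ + it) dt + i ∫_{1/2}^{3/2} G(x + iT) dx`. -/
theorem setIntegral_termIntegrand_eq (n : ℕ) {m : ℕ} (hm : 0 < m) {T : ℝ} (hT : 1 ≤ T) :
    ∫ y in Ioi T, termIntegrand n m y =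
      (∫ t in Ioi T, G n m (1 / 2 + t * I)) + I * ∫ x in (1 / 2 : ℝ)..(3 / 2 : ℝ), G n m (x + T * I) := by
  have hT0 : 0 < T := by linarith
  -- the three limits
  have hR : Tendsto (fun Y ↦ ∫ y in T..Y, G n m (3 / 2 + y * I)) atTop (𝓝 (∫ y in Ioi T, termIntegrand n m y)) :=
    intervalIntegral_tendsto_integral_Ioi T (integrableOn_termIntegrand n hm hT) tendsto_id
  have hL : Tendsto (fun Y ↦ ∫ t in T..Y, G n m (1 / 2 + t * I)) atTop (𝓝 (∫ t in Ioi T, G n m (1 / 2 + t * I))) :=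
    intervalIntegral_tendsto_integral_Ioi T (integrable_G_half n hm).integrableOn tendsto_id
  have htop : Tendsto (fun Y : ℝ ↦ I * ∫ x in (1 / 2 : ℝ)..(3 / 2 : ℝ), G n m (x + Y * I)) atTop (𝓝 0) := by
    rw [tendsto_zero_iff_norm_tendsto_zero]
    have hbound : ∀ᶠ Y : ℝ in atTop, ‖I * ∫ x in (1 / 2 : ℝ)..(3 / 2 : ℝ), G n m (x + Y * I)‖ ≤
        (m : ℝ) ^ (-(1 / 2 : ℝ)) * ((n : ℝ) ^ 2 * Real.exp (n / T ^ 2)) * (Y ^ 2)⁻¹ := by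
      filter_upwards [eventually_ge_atTop T] with Y hY
      have hY0 : 0 < Y := hT0.trans_le hY
      rw [norm_mul, Complex.norm_I, one_mul]
      have hpt : ∀ x ∈ Ι (1 / 2 : ℝ) (3 / 2), ‖G n m (x + Y * I)‖ ≤
          (m : ℝ) ^ (-(1 / 2 : ℝ)) * ((n : ℝ) ^ 2 * Real.exp (n / T ^ 2)) * (Y ^ 2)⁻¹ := by
        intro x hx
        rw [uIoc_of_le (by norm_num)] at hx
        refine (norm_G_le_decay n hm ⟨hx.1.le, hx.2⟩ hY0).trans ?_
        have hexp : Real.exp (n / Y ^ 2) ≤ Real.exp (n / T ^ 2) :=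
          Real.exp_le_exp.2 (div_le_div_of_nonneg_left (Nat.cast_nonneg n) (by positivity)
            (pow_le_pow_left₀ hT0.le hY 2))
        calc (m : ℝ) ^ (-(1 / 2 : ℝ)) * ((n : ℝ) ^ 2 * Real.exp (n / Y ^ 2) / Y ^ 2)
            ≤ (m : ℝ) ^ (-(1 / 2 : ℝ)) * ((n : ℝ) ^ 2 * Real.exp (n / T ^ 2) / Y ^ 2) := by gcongr
          _ = _ := by ring
      have h := intervalIntegral.norm_integral_le_of_norm_le_const hpt
      have hlen : |(3 / 2 : ℝ) - 1 / 2| = 1 := by norm_num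
      rw [hlen, mul_one] at h
      exact h
    have hlim : Tendsto (fun Y : ℝ ↦ (m : ℝ) ^ (-(1 / 2 : ℝ)) * ((n : ℝ) ^ 2 * Real.exp (n / T ^ 2)) * (Y ^ 2)⁻¹)
        atTop (𝓝 0) := by
      have h2 : Tendsto (fun Y : ℝ ↦ (Y ^ 2)⁻¹) atTop (𝓝 0) := (tendsto_pow_atTop two_ne_zero).inv_tendsto_atTop
      simpa using h2.const_mul ((m : ℝ) ^ (-(1 / 2 : ℝ)) * ((n : ℝ) ^ 2 * Real.exp (n / T ^ 2)))
    exact squeeze_zero' (Filter.Eventually.of_forall fun Y ↦ norm_nonneg _) hbound hlim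
  have heq : ∀ᶠ Y : ℝ in atTop, (∫ y in T..Y, G n m (3 / 2 + y * I)) = (∫ t in T..Y, G n m (1 / 2 + t * I)) +
      I * (∫ x in (1 / 2 : ℝ)..(3 / 2 : ℝ), G n m (x + T * I)) - I * ∫ x in (1 / 2 : ℝ)..(3 / 2 : ℝ), G n m (x + Y * I) := by
    filter_upwards [eventually_ge_atTop T] with Y hY
    exact integral_right_eq n hm hT0 hY
  have h2 := ((hL.add_const (I * ∫ x in (1 / 2 : ℝ)..(3 / 2 : ℝ), G n m (x + T * I))).sub htop)
  rw [sub_zero] at h2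
  exact tendsto_nhds_unique (hR.congr' heq) h2

end PrimeTail

end Summit.RiemannHypothesis.RiemannHypothesis.Theorems.LiTheory

end
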